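import Literature.NumberTheory.EllipticCurves.HeegnerStabilizedClassExistenceProofs
import Literature.NumberTheory.EllipticCurves.HeegnerEnvelopeUnitTwistProofs
import Mathlib.RingTheory.PowerSeries.PiTopology
import Mathlib.NumberTheory.Padics.ProperSpace
import Mathlib.Topology.MetricSpace.Ultra.Basic
import HarnessLib

/-!
# The stabilised Heegner module is CYCLIC: `Λκ_∞(C) = stabilizedHeegnerModule D C = Λ ∙ κ_∞`
# (CGLS 2022 Rem. 4.1.4 «`κ_∞ := lim←_k κ_k` … `κ_∞` and `κ₁^{Hg}` generate the same `Λ`-submodule»;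
# Howard 2004 Thm. 3.3.7 «`𝐇` is generated by `κ̃₁`»; Perrin-Riou 1987 §3.4; proofs file)

Topic `NumberTheory/EllipticCurves`. THEOREMS ONLY (no definition, no named fact, no `sorry`, no instance);
sequel of `HeegnerStabilizedClassExistenceProofs` (the class `κ_∞`). Written by the cell `bsd-print-x9` seat
`bsd-line-x9-p2` (g2) for the shared μ-item of the cruxes stmt-BirchSwinnertonDyer-27077 (`PrintX9`) / 27275
(`PrintX10b`): with this file the `SpecWitness.map_le` clause `f(Λκ_∞(C)) ≤ S_m ∙ κ₁` of the specialised
Kolyvagin-system port holds with `κ₁ := f κ_∞` for EVERY `Λ`-linear `f` (`map_stabilizedHeegnerModule_eq_span`),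
and the printed identification «`Λκ_∞ = Λκ₁^{Hg}`» only has to be cited for the ELEMENT `κ_∞` (pinned by its
projections), not for the tree's module `stabilizedHeegnerModule`.

THE ARGUMENT. `stabilizedHeegnerModule D C` is the `Λ`-span of the elements `s ∈ 𝔖` all of whose projections
above the torsion depth lie in the level modules `ℤ_p[G_k]·δ(κ_k)`; `κ_∞` is such an element and its projection
GENERATES the level module (`proj_k κ_∞ = ε_k · δ(κ_k)`, `ε_k ∈ ℤ_p^×`), so for every such `s` and every `k > δ`
there is `f_k ∈ Λ` (a group-ring element `Σ cᵢ (1+T)^i` times `ε_k⁻¹`) with `proj_k s = proj_k (f_k • κ_∞)`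
(§2). The sets `Z_k = {f ∈ Λ : proj_k (f • κ_∞) = proj_k s}` are non-empty, DECREASING (a projection determines
the lower ones: universal norms + injectivity of restriction under `E(K)[p] = 0`,
`resPi_layer_injective_of_noPTorsion`) and CLOSED in the compact space `Λ = ℤ_p⟦T⟧` (product topology of the
compact `ℤ_p`, Mathlib `PowerSeries.WithPiTopology`, `PadicInt.compactSpace`): the `(k, m)` component of
`proj_k (f • κ_∞)` only depends on the coefficients `coeff_i f mod p^m`, `i < m p^k` (`proj_C`, `proj_cont`), a
locally constant function of `f`. Cantor's intersection theorem gives `f ∈ ⋂_k Z_k`, and `s = f • κ_∞` by the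
joint injectivity of the projections (§3). Hence `Λκ_∞(C) = Λ ∙ κ_∞` (§4); with the torsion-freeness of `𝔖`
(CGLS §3.3, the tree's `thm411…` clause) it is free of rank one as soon as it is non-zero (§5).

WHAT.
* §1 `LambdaAdicSelmerData.proj_eq_of_proj_add_eq`, `….eq_of_forall_le_proj_eq` (an element of `𝔖` is determined
  by its projections above any level, `E(K)[p] = 0`); `eq_of_proj_mem_stabilizedClassLayer` (UNIQUENESS of `κ_∞`).
* §2 `exists_eq_proj_smul_of_mem_stabilizedModuleLayer` (levelwise generation).
* §3 `LambdaAdicSelmerData.proj_smul_apply_eq_of_forall_coeff_dvd` (local constancy),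
  **`LambdaAdicSelmerData.exists_eq_smul_of_forall_exists_proj_eq`** (the `Λ`-adic limit, by compactness of `Λ`).
* §4 **`stabilizedHeegnerModule_eq_span_singleton`** (`Λκ_∞(C) = Λ ∙ κ_∞` for any class with projections
  `ε_k · δ(κ_k)`), **`exists_stabilizedHeegnerModule_eq_span_singleton_of_coherent`** (for a coherent datum such a
  generator exists), `map_stabilizedHeegnerModule_eq_span_singleton` (`f(Λκ_∞(C)) = S ∙ f(κ_∞)`).
* §5 `free_finrank_eq_one_stabilizedHeegnerModule_of_eq_span_singleton` (free of rank one when `𝔖` is torsion-free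
  and `Λκ_∞(C) ≠ 0`).
HONEST FRAMING: module bookkeeping over the tree's abstract `𝔖_p(K_∞)`; the only analysis is the compactness of
`ℤ_p⟦T⟧`; nothing about any particular curve; «beyond-print theorem»: no; BSD is not proved by any of this.

References: [CastellaGrossiLeeSkinner2022] Rem. 4.1.4 (arXiv:2008.02571v2 TeX L2278–2294); [Howard2004HeegnerKolyvagin]
Thm. 3.3.7, §3.3; [PerrinRiou1987BSMF] §0 p. 402, §3.4 Prop. 10; [Washington1997] §13.2 (Λ = ℤ_p⟦T⟧ compact,
Λ = lim← ℤ_p[Gal(K_n/K)]); [GreenbergLNM1716] §3 Lemma 3.1, §4 p. 109 (restriction injective when E(F)[p] = 0).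
-/

set_option autoImplicit false

noncomputable section

open scoped Classical PowerSeries.WithPiTopology

open WeierstrassCurve Literature.NumberTheory.EllipticCurves
  Literature.NumberTheory.EllipticCurves.CastellaGrossiLeeSkinner2022 PowerSeries

namespace Literature.NumberTheory.EllipticCurves

/-! ## §1 An element of `𝔖` is determined by its projections above any level; uniqueness of `κ_∞` -/

section Unique

variable {K : Type} [Field K] [NumberField K] {V : WeierstrassCurve K} [V.IsElliptic] {p : ℕ} [Fact p.Prime]
  {κ : ZpExtension K p} {γ : Field.absoluteGaloisGroup K} (D : V.LambdaAdicSelmerData κ γ)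

/-- **A projection of `𝔖_p(K_∞)` determines the lower ones** (`E(K)[p] = 0`): if `proj_{k+n} s = proj_{k+n} t` then
`proj_k s = proj_k t`, since `res_{K_k}^{K_{k+n}} (proj_k s) = 𝒩 (proj_{k+n} s)` (universal norms) and restriction
is injective. [cite: PerrinRiou1987BSMF, §0 p. 402 (𝔖_p = lim← along corestriction)]
[cite: GreenbergLNM1716, §3 Lemma 3.1 and §4 p. 109 (restriction injective when E(F)[p] = 0)] -/
theorem _root_.WeierstrassCurve.LambdaAdicSelmerData.proj_eq_of_proj_add_eq
    (hE : ∀ P : V.toAffine.Point, p • P = 0 → P = 0) {s t : D.S} {k n : ℕ}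
    (h : D.proj (k + n) s = D.proj (k + n) t) : D.proj k s = D.proj k t := by
  apply V.resPi_layer_injective_of_noPTorsion p κ hE (κ.layerSubgroup_antitone (Nat.le_add_right k n))
  rw [D.resPi_proj_eq_sum_conjPi_proj k n s, D.resPi_proj_eq_sum_conjPi_proj k n t, h]

/-- **An element of `𝔖_p(K_∞)` is determined by its projections to the layers `k ≥ k₀`** when `E(K)[p] = 0`.
[cite: PerrinRiou1987BSMF, §0 p. 402 (𝔖_p = lim← along corestriction)]
[cite: GreenbergLNM1716, §3 Lemma 3.1 and §4 p. 109] -/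
theorem _root_.WeierstrassCurve.LambdaAdicSelmerData.eq_of_forall_le_proj_eq
    (hE : ∀ P : V.toAffine.Point, p • P = 0 → P = 0) (k₀ : ℕ) {s t : D.S}
    (h : ∀ k, k₀ ≤ k → D.proj k s = D.proj k t) : s = t := by
  refine D.proj_injective (funext fun k ↦ ?_)
  by_cases hk : k₀ ≤ k
  · exact h k hk
  · obtain ⟨n, hn⟩ : ∃ n, k₀ = k + n := ⟨k₀ - k, by omega⟩
    exact D.proj_eq_of_proj_add_eq hE (h (k + n) hn.le)

end Unique

section UniqueClass

variable {N : ℕ} [NeZero N] {W : WeierstrassCurve ℚ} [W.IsGloballyMinimal] [W.IsElliptic] {K : Type}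
  [Field K] [NumberField K] {p : ℕ} [Fact p.Prime] {κ : ZpExtension K p} {γ : Field.absoluteGaloisGroup K}
  {jbar : AlgebraicClosure K →+* ℂ} (D : (W.baseChange K).LambdaAdicSelmerData κ γ)
  (C : StabilizedHeegnerData N W K κ jbar)

/-- **UNIQUENESS OF `κ_∞`**: two elements of `𝔖` whose projections above the depth are representatives of CGLS's
`δ(κ_k)` are equal, when `E(K)[p] = 0`. [cite: CastellaGrossiLeeSkinner2022, Rem. 4.1.4 (κ_∞ := lim←_k κ_k)]
[cite: PerrinRiou1987BSMF, §0 p. 402] -/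
theorem eq_of_proj_mem_stabilizedClassLayer
    (hE : ∀ P : (W.baseChange K).toAffine.Point, p • P = 0 → P = 0) {z z' : D.S}
    (hz : ∀ (k : ℕ) (hk : C.depth < k), D.proj k z ∈ stabilizedClassLayer C k hk)
    (hz' : ∀ (k : ℕ) (hk : C.depth < k), D.proj k z' ∈ stabilizedClassLayer C k hk) : z = z' :=
  D.eq_of_forall_le_proj_eq hE (C.depth + 1) fun k hk ↦
    stabilizedClassLayer_eq_of_mem C k hk (hz k hk) (hz' k hk)

end UniqueClass

/-! ## §2 Levelwise: `ℤ_p[G_k]·δ(κ_k) = {proj_k (f • κ_∞) : f ∈ Λ}` -/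

section Levelwise

variable {N : ℕ} [NeZero N] {W : WeierstrassCurve ℚ} [W.IsGloballyMinimal] [W.IsElliptic] {K : Type}
  [Field K] [NumberField K] {p : ℕ} [Fact p.Prime] {κ : ZpExtension K p} {γ : Field.absoluteGaloisGroup K}
  {jbar : AlgebraicClosure K →+* ℂ} (D : (W.baseChange K).LambdaAdicSelmerData κ γ)
  (C : StabilizedHeegnerData N W K κ jbar) (k : ℕ) (hk : C.depth < k)

/-- **Levelwise generation**: if `proj_k z = ε · x` with `x` a representative of `δ(κ_k)` and `ε ∈ ℤ_p^×`, then every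
element of the level module `ℤ_p[Gal(K_k/K)]·δ(κ_k)` is `proj_k (f • z)` for some `f ∈ Λ` (a group-ring element
`Σ cᵢ (1+T)^i` times `ε⁻¹`: `proj_C`, `proj_one_add_X_pow_smul`).
[cite: CastellaGrossiLeeSkinner2022, Rem. 4.1.4 (the module of the κ_k)] [cite: PerrinRiou1987BSMF, §0 p. 402 (𝔖_p as a ℤ_p⟦Gal⟧-module)] -/
theorem exists_eq_proj_smul_of_mem_stabilizedModuleLayer {z : D.S} {e : ℤ_[p]} (he : IsUnit e)
    {x : (W.baseChange K).torsionH1Pi p (κ.layerSubgroup k)} (hx : x ∈ stabilizedClassLayer C k hk)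
    (hz : D.proj k z = (W.baseChange K).padicPi p (κ.layerSubgroup k) e x)
    {y : (W.baseChange K).torsionH1Pi p (κ.layerSubgroup k)} (hy : y ∈ stabilizedModuleLayer γ C k hk) :
    ∃ f : IwasawaAlgebra p, y = D.proj k (f • z) := by
  -- `x = proj_k (C ε⁻¹ • z)`
  have hx' : x = D.proj k ((PowerSeries.C (Ring.inverse e) : IwasawaAlgebra p) • z) := by
    rw [D.proj_C, hz, padicPi_padicPi, Ring.inverse_mul_cancel _ he, padicPi_one]
  unfold stabilizedModuleLayer at hy
  induction hy using AddSubgroup.closure_induction with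
  | mem w hw =>
    obtain ⟨c, i, x', hx'mem, rfl⟩ := hw
    refine ⟨(PowerSeries.C c : IwasawaAlgebra p) * (1 + PowerSeries.X) ^ i * PowerSeries.C (Ring.inverse e), ?_⟩
    rw [stabilizedClassLayer_eq_of_mem C k hk hx'mem hx, mul_smul, mul_smul, D.proj_C, proj_one_add_X_pow_smul,
      ← hx']
  | zero => exact ⟨0, by rw [zero_smul, map_zero]⟩
  | add a b _ _ ha hb =>
    obtain ⟨f, rfl⟩ := ha
    obtain ⟨g, rfl⟩ := hb
    exact ⟨f + g, by rw [add_smul, map_add]⟩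
  | neg a _ ha =>
    obtain ⟨f, rfl⟩ := ha
    exact ⟨-f, by rw [neg_smul, map_neg]⟩

end Levelwise

/-! ## §3 The `Λ`-adic limit: compactness of `Λ = ℤ_p⟦T⟧` -/

section Limit

variable {K : Type} [Field K] [NumberField K] {V : WeierstrassCurve K} {p : ℕ} [Fact p.Prime]
  {κ : ZpExtension K p} {γ : Field.absoluteGaloisGroup K} (D : V.LambdaAdicSelmerData κ γ)

/-- **Local constancy of the `Λ`-action at a component**: if `f` and `g` have the same coefficients modulo `p^m` in
degrees `< m·p^k`, then `proj_k (g • z)` and `proj_k (f • z)` have the same `m`-th component — a power series with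
coefficients in `p^m ℤ_p` below degree `m p^k` acts as `0` there (`proj_C`: constants act through `ℤ/p^m`;
`proj_cont`: no terms of degree `< m p^k` ⟹ `0`). [cite: PerrinRiou1987BSMF, §0 p. 402 (continuity of the Λ-action on 𝔖_p)] -/
theorem _root_.WeierstrassCurve.LambdaAdicSelmerData.proj_smul_apply_eq_of_forall_coeff_dvd (z : D.S) (k m : ℕ)
    {f g : IwasawaAlgebra p} (h : ∀ i < m * p ^ k, ((p : ℤ_[p]) ^ m) ∣ PowerSeries.coeff i (g - f)) :
    D.proj k (g • z) m = D.proj k (f • z) m := by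
  -- split `g - f = C (p^m) * q + r` with `r` without terms of degree `< m p^k`
  choose! q hq using h
  set qq : IwasawaAlgebra p := PowerSeries.mk fun i ↦ if i < m * p ^ k then q i else 0 with hqq
  set r : IwasawaAlgebra p := (g - f) - PowerSeries.C ((p : ℤ_[p]) ^ m) * qq with hr
  have hrcoeff : ∀ i < m * p ^ k, PowerSeries.coeff i r = 0 := by
    intro i hi
    rw [hr, map_sub, PowerSeries.coeff_C_mul, hqq, PowerSeries.coeff_mk, if_pos hi, hq i hi, sub_self]
  have hgf : g = f + (PowerSeries.C ((p : ℤ_[p]) ^ m) * qq + r) := by rw [hr]; ring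
  rw [hgf, add_smul, map_add, Pi.add_apply, add_smul, map_add, Pi.add_apply, D.proj_cont k m z r hrcoeff,
    add_zero, mul_smul, D.proj_C, padicPi_apply, map_pow, map_natCast]
  have h0 : ((p : ZMod (p ^ m)) ^ m) = 0 := by rw [← Nat.cast_pow, ZMod.natCast_self]
  rw [h0, ZMod.val_zero, Nat.cast_zero, zero_smul, add_zero]

variable [V.IsElliptic]

/-- **THE `Λ`-ADIC LIMIT.** Let `E(K)[p] = 0` and `z, s ∈ 𝔖_p(K_∞)`. If for every layer `k ≥ k₀` there is
`f_k ∈ Λ` with `proj_k s = proj_k (f_k • z)`, then `s = f • z` for ONE `f ∈ Λ`. The sets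
`Z_k = {f : proj_k (f • z) = proj_k s}` are closed (local constancy of each component), decreasing (a
projection determines the lower ones) and non-empty in the COMPACT space `Λ = ℤ_p⟦T⟧` (product topology,
`ℤ_p` compact); a point of `⋂_k Z_k` (Cantor) works by the joint injectivity of the projections.
[cite: Washington1997, §13.2 (Λ ≅ lim← ℤ_p[Gal(K_n/K)], compactness)] [cite: PerrinRiou1987BSMF, §0 p. 402] -/
theorem _root_.WeierstrassCurve.LambdaAdicSelmerData.exists_eq_smul_of_forall_exists_proj_eq
    (hE : ∀ P : V.toAffine.Point, p • P = 0 → P = 0) (z s : D.S) (k₀ : ℕ)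
    (h : ∀ k, k₀ ≤ k → ∃ f : IwasawaAlgebra p, D.proj k s = D.proj k (f • z)) :
    ∃ f : IwasawaAlgebra p, s = f • z := by
  haveI : CompactSpace (IwasawaAlgebra p) := by
    change CompactSpace ((Unit →₀ ℕ) → ℤ_[p])
    infer_instance
  -- each component is a locally constant function of `f`
  have hloc : ∀ k m : ℕ, IsLocallyConstant fun f : IwasawaAlgebra p ↦ D.proj k (f • z) m := by
    intro k m
    refine (IsLocallyConstant.iff_exists_open _).mpr fun f ↦ ?_
    have hr : ((p : ℝ) ^ (-(m : ℤ))) ≠ 0 :=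
      zpow_ne_zero _ (Nat.cast_ne_zero.mpr (Fact.out : p.Prime).ne_zero)
    refine ⟨⋂ i ∈ Finset.range (m * p ^ k),
        (fun g : IwasawaAlgebra p ↦ PowerSeries.coeff i g) ⁻¹' Metric.closedBall (PowerSeries.coeff i f)
          ((p : ℝ) ^ (-(m : ℤ))), ?_, ?_, fun g hg ↦ ?_⟩
    · exact isOpen_biInter_finset fun i _ ↦
        (IsUltrametricDist.isOpen_closedBall _ hr).preimage (PowerSeries.WithPiTopology.continuous_coeff _ i)
    · simp only [Set.mem_iInter, Set.mem_preimage]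
      exact fun i _ ↦ Metric.mem_closedBall_self (zpow_pos (Nat.cast_pos.mpr (Fact.out : p.Prime).pos) _).le
    · simp only [Set.mem_iInter, Set.mem_preimage, Metric.mem_closedBall, dist_eq_norm] at hg
      refine D.proj_smul_apply_eq_of_forall_coeff_dvd z k m fun i hi ↦ ?_
      rw [map_sub, ← Ideal.mem_span_singleton, ← PadicInt.norm_le_pow_iff_mem_span_pow]
      exact hg i (Finset.mem_range.mpr hi)
  -- the closed, decreasing, non-empty sets `Z_k`
  set Z : ℕ → Set (IwasawaAlgebra p) := fun k ↦ {f | ∀ m, D.proj k (f • z) m = D.proj k s m} with hZ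
  have hZcl : ∀ k, IsClosed (Z k) := fun k ↦ by
    have : Z k = ⋂ m, (fun f : IwasawaAlgebra p ↦ D.proj k (f • z) m) ⁻¹' {D.proj k s m} := by
      ext f; simp [hZ]
    rw [this]
    exact isClosed_iInter fun m ↦ (hloc k m).isClosed_fiber _
  have hZmono : ∀ k n, Z (k + n) ⊆ Z k := fun k n f hf ↦ by
    have hf' : D.proj (k + n) (f • z) = D.proj (k + n) s := funext hf
    exact fun m ↦ congrFun (D.proj_eq_of_proj_add_eq hE hf') m
  have hZne : ∀ k, (Z k).Nonempty := fun k ↦ by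
    obtain ⟨f, hf⟩ := h (k + k₀) (Nat.le_add_left _ _)
    exact ⟨f, hZmono k k₀ fun m ↦ (congrFun hf m).symm⟩
  obtain ⟨f, hf⟩ := IsCompact.nonempty_iInter_of_sequence_nonempty_isCompact_isClosed Z
    (fun k ↦ hZmono k 1) hZne (hZcl 0).isCompact hZcl
  refine ⟨f, (D.proj_injective (funext fun k ↦ funext fun m ↦ ?_)).symm⟩
  exact (Set.mem_iInter.mp hf k) m

end Limit

/-! ## §4 Cyclicity -/

section Cyclic

variable {N : ℕ} [NeZero N] {W : WeierstrassCurve ℚ} [W.IsGloballyMinimal] [W.IsElliptic] {K : Type}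
  [Field K] [NumberField K] {p : ℕ} [Fact p.Prime] {κ : ZpExtension K p} {γ : Field.absoluteGaloisGroup K}
  {jbar : AlgebraicClosure K →+* ℂ} (D : (W.baseChange K).LambdaAdicSelmerData κ γ)
  (C : StabilizedHeegnerData N W K κ jbar)

/-- **CYCLICITY OF THE STABILISED HEEGNER MODULE**: if `z ∈ 𝔖` has projections `ε_k · δ(κ_k)` (`ε_k ∈ ℤ_p^×`) at
every layer `k > δ` and `E(K)[p] = 0`, then `Λκ_∞(C) = stabilizedHeegnerModule D C = Λ ∙ z`: the spanning elements
of `Λκ_∞(C)` are `Λ`-multiples of `z` (levelwise generation §2 + the `Λ`-adic limit §3), and `z` is one of them.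
This is CGLS's «`κ_∞` generates `Λκ_∞`» / Howard's «`𝐇 = lim← H_k` is generated by the compatible family» for the
tree's `stabilizedHeegnerModule`, at any class number.
[cite: CastellaGrossiLeeSkinner2022, Rem. 4.1.4 (arXiv:2008.02571v2 TeX L2278–2294)] [cite: Howard2004HeegnerKolyvagin, Thm. 3.3.7 and §3.3]
[cite: PerrinRiou1987BSMF, §3.4 Prop. 10] -/
theorem stabilizedHeegnerModule_eq_span_singleton
    (hE : ∀ P : (W.baseChange K).toAffine.Point, p • P = 0 → P = 0) {z : D.S}
    (hz : ∀ (k : ℕ) (hk : C.depth < k), ∃ e : ℤ_[p], IsUnit e ∧ ∃ x ∈ stabilizedClassLayer C k hk,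
      D.proj k z = (W.baseChange K).padicPi p (κ.layerSubgroup k) e x) :
    stabilizedHeegnerModule D C = Submodule.span (IwasawaAlgebra p) {z} := by
  refine le_antisymm ?_ ?_
  · refine Submodule.span_le.mpr fun s hs ↦ ?_
    obtain ⟨f, rfl⟩ := D.exists_eq_smul_of_forall_exists_proj_eq hE z s (C.depth + 1) fun k hk ↦ by
      obtain ⟨e, he, x, hx, hzx⟩ := hz k hk
      obtain ⟨f, hf⟩ := exists_eq_proj_smul_of_mem_stabilizedModuleLayer D C k hk he hx hzx (hs k hk)
      exact ⟨f, hf⟩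
    exact Submodule.smul_mem _ _ (Submodule.subset_span rfl)
  · rw [Submodule.span_le, Set.singleton_subset_iff]
    exact mem_stabilizedHeegnerModule_of_proj_eq_padicPi D C fun k hk ↦
      (hz k hk).elim fun e he ↦ ⟨e, he.2⟩

/-- **CYCLICITY FOR COHERENT DATA**: for a coherent CGLS datum ((P1′)/(P1″)/(P2′) with an integer Lucas pair and
jumps, the letters of `exists_coherentPair`), at a good ordinary `p`, `γ` a topological generator, `E(K)[p] = 0`,
there is `κ_∞ ∈ 𝔖` with projections `ε_k · δ(κ_k)` above the depth AND `Λκ_∞(C) = Λ ∙ κ_∞`.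
[cite: CastellaGrossiLeeSkinner2022, Rem. 4.1.4 (arXiv:2008.02571v2 TeX L2278–2294)] [cite: Howard2004HeegnerKolyvagin, Thm. 3.3.7]
[cite: PerrinRiou1987BSMF, §3.4 Prop. 10] -/
theorem exists_stabilizedHeegnerModule_eq_span_singleton_of_coherent (hord : IsOrdinaryAt W p)
    (hγ : κ.IsTopGenerator γ) (hE : ∀ P : (W.baseChange K).toAffine.Point, p • P = 0 → P = 0)
    (A B : ℕ → ℤ) (hA0 : A 0 = 1) (hA1 : A 1 = W.frobeniusTrace p)
    (hA : ∀ m, A (m + 2) = W.frobeniusTrace p * A (m + 1) - p * A m)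
    (hB0 : B 0 = 0) (hB1 : B 1 = -1) (hB : ∀ m, B (m + 2) = W.frobeniusTrace p * B (m + 1) - p * B m)
    (ns : ℕ → ℕ) (hv1 : ∀ j, C.depth < j → C.v (j + 1) = A (ns j) • C.u j + B (ns j) • C.v j)
    (hvfix : ∀ j, C.depth < j → ∀ σ ∈ κ.layerSubgroup j, σ • C.v (j + 1) = C.v (j + 1))
    (hnorm : ∀ j, C.depth < j →
      ∑ i ∈ Finset.range p, (γ ^ (p ^ j * i)) • C.u (j + 1) = A (ns j + 1) • C.u j + B (ns j + 1) • C.v j) :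
    ∃ z : D.S, (∀ (k : ℕ) (hk : C.depth < k), ∃ e : ℤ_[p], IsUnit e ∧ ∃ x ∈ stabilizedClassLayer C k hk,
        D.proj k z = (W.baseChange K).padicPi p (κ.layerSubgroup k) e x) ∧
      stabilizedHeegnerModule D C = Submodule.span (IwasawaAlgebra p) {z} := by
  obtain ⟨z, hz⟩ := exists_proj_eq_padicPi_unit_of_coherent D C hord hγ A B hA0 hA1 hA hB0 hB1 hB ns hv1 hvfix
    hnorm
  exact ⟨z, hz, stabilizedHeegnerModule_eq_span_singleton D C hE hz⟩

omit [W.IsElliptic] in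
/-- **The image of `Λκ_∞(C)` under any `Λ`-linear map is the line of the image of the generator**:
`f(Λκ_∞(C)) = Λ ∙ f(κ_∞)` — the `SpecWitness.map_le` clause of the specialised-Kolyvagin-system port with
`κ₁ := f κ_∞`. [cite: CastellaGrossiLeeSkinner2022, Rem. 4.1.4] [cite: Howard2004HeegnerKolyvagin, proof of Thm. 2.2.10 (specialisation of κ₁)] -/
theorem map_stabilizedHeegnerModule_eq_span_singleton {z : D.S}
    (h : stabilizedHeegnerModule D C = Submodule.span (IwasawaAlgebra p) {z})
    {M : Type*} [AddCommGroup M] [Module (IwasawaAlgebra p) M] (f : D.S →ₗ[IwasawaAlgebra p] M) :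
    (stabilizedHeegnerModule D C).map f = Submodule.span (IwasawaAlgebra p) {f z} := by
  rw [h, Submodule.map_span, Set.image_singleton]

/-! ## §5 Free of rank one -/

omit [W.IsElliptic] in
/-- **`Λκ_∞(C)` is free of rank one** when it is cyclic, non-zero and `𝔖` has no `Λ`-torsion (the torsion-freeness
is CGLS §3.3 / the tree's `thm411…` clause; non-vanishing is Cornut–Vatsal via CGLS Thm. 4.1.1): the analogue of
Howard's «`𝐇` is free of rank one» for the stabilised module at any class number.
[cite: Howard2004HeegnerKolyvagin, Thm. 3.3.7] [cite: CastellaGrossiLeeSkinner2022, Thm. 4.1.1 and Rem. 4.1.4] -/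
theorem free_finrank_eq_one_stabilizedHeegnerModule_of_eq_span_singleton
    [NoZeroSMulDivisors (IwasawaAlgebra p) D.S] {z : D.S}
    (h : stabilizedHeegnerModule D C = Submodule.span (IwasawaAlgebra p) {z})
    (hne : stabilizedHeegnerModule D C ≠ ⊥) :
    Module.Free (IwasawaAlgebra p) (stabilizedHeegnerModule D C) ∧
      Module.finrank (IwasawaAlgebra p) (stabilizedHeegnerModule D C) = 1 := by
  have hz : z ≠ 0 := by
    rintro rfl
    exact hne (by rw [h, Submodule.span_singleton_eq_bot])
  let e : (IwasawaAlgebra p) ≃ₗ[IwasawaAlgebra p] stabilizedHeegnerModule D C :=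
    (LinearEquiv.toSpanNonzeroSingleton (IwasawaAlgebra p) D.S z hz).trans (LinearEquiv.ofEq _ _ h.symm)
  exact ⟨Module.Free.of_equiv e, by rw [← e.finrank_eq, Module.finrank_self]⟩

end Cyclic

end Literature.NumberTheory.EllipticCurves

end
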